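import Summits.QuantumFields.YangMills.Theorems.BalabanUVNodesN27AtAdmReadingOfRecord13CoPH
import Summits.QuantumFields.YangMills.Theorems.BalabanUVNodesN18AtRateRecord13CoPHTermDatum
import Summits.QuantumFields.YangMills.Theorems.BalabanUVNodesN16AtRRec13CoPHLeafSlotAT

/-!
# BalabanUVNodes ∕ N27 = binder B5 AT THE RECORD — N27 AT THE ADMISSIBLE `CoPH` READING ON THE RUN TOWERS GENERATED BY W1's (2.14) TERM DATA `runTowers (k ↦ toClusterTower (𝔇 F θ k).Gn₀)`,
# N18 IN THE MOST LOCATED CURRENCY IN THE TREE: THE END's DATA + NODE A's LOCATED INPUTS PER TERM (trigger (t2) of this seat: a producer face in a NEW currency at the v1.7 `CoPH` reading):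
# XLIᶜᵒᵖᴴ `…N27AtAdmReadingOfRecord13CoPH` (p545621) INSTANTIATED at the term-data towers, its N18 slot REPLACED by dag-n18-d's rows `YMDAG.N18.W1Reading.s_N18_rRec₁₃CoPH(On)_readingAdm_runTowers_Gn₀_of_inputs226Holo_pin`
# (`…N18AtRateRecord13CoPHTermDatum`, 15:48Z; dag-n18-c file 33 `…N18AtTermDatumInputs226` p525011 underneath — its author: «the most located junction of node N18 in the tree: … module 18g §2
# with the abstract schema (GEN) REPLACED by the located records»), hypothesis VERBATIM: per admissible Stage-13 tuple with provisos (cube size `θ.τ9.M ≥ 1` as the instance binder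
# `[NeZero θ.τ9.M]`) and run length `k` — (i) THE END's data over the carriers of the admissible level pairing of the run towers (NODE-A majorant as hypothesis, L01–L03 ∕ L07 ∕ L08 ∕
# L09* ∕ L10, numerals) and (ii)′ per torus: restriction-closed tables `sp` inside OPEN located-inputs tables `big`, the [II] (2.26) numerals `Lemma3Numerics (c F θ k) …`, ONE W1 STOREY-8
# record `(𝔇 F θ k m).Inputs226Holo (c F θ k) Z t s old φ₁ aA a₅A` per table point ∕ term `t ∈ terms (L F θ k) θ.τ9.M Z` with its analyticity ∕ measurability ∕ symmetry ∕ positivity ∕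
# quadratic-form ∕ decay ∕ closeness clauses, the dominations `0 ≤ C₃ε₁ ≤ A`, `R_d ≤ (1−8δ)·½L·κ`, renewals, `]0, γ′] ⊆ Dc F θ`, letters dominating; N16 AT-keyed (dag-n16-e 39ᴴ)
# (cell `pub-ymgap`, HUMAN RULING D-0062 Track A, R134 seat `pub-ymgap-dag-n27-c` (s2) gen 9; K3⁷ `SpineGivenEndpointR13SepCoPH` = stmt-QuantumFields-20544, `--kind proof --supports 20544 --as helper`;
# COUNT-NEUTRAL; `N`-generic, regime-generic, NO Theses import — the item-facing face is ONE application of leaf A §4 at `Rg := Node00.unityNondeg₁₃H 2`, `N = 2` at the call site)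

THE READING.  `readingOfRecord₁₃CoPH (fun F θ ↦ ReadingData.ofRecordAdm F θ.τ9.M N (runTowers fun k ↦ toClusterTower (𝔇 F θ k).Gn₀) (sp F θ) (gauge F θ) (hg F θ) (T₀ F θ) (hT₀ F θ) (li F θ)) ℓ₃ ne2 ne1`
— term data `𝔇 F θ k : TermData214 (c₀ F θ k) (F.P k) (M_N ℂ) θ.τ9.M (L F θ k)`, tables `sp ⊆ big`, gauges, transports with clause `hT₀`, letters `li`, coupling domains `Dc F θ`: PARAMETERS.

WHAT IS KERNEL-CHECKED ([bookkeeping]; 0 `def`, 0 `sorry`; ONE theorem = ONE application of XLᶜᵒᵖᴴ `spine_rec13CCoPH_at_readingOfRecord₁₃CoPH` with dag-n18-d's term-data row in the N18 slot,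
dag-n22-e 8a″ (`S := fun F θ ↦ runTowers …`) eliminating N22 given N18, dag-n16-e 39ᴴ in the N16 slot; the regime twin is the companion module `…AtTermDatumTowers13CoPHOn` — split for the
400-line cap, the N18 binder alone is ≈ 120 lines):
* `spine_rec13CCoPH_at_termDatumTowers₁₃CoPH` — CANONICAL HOME: N22 ⟸ N18 (analytic currency, (J), (A), eleven numerals VERBATIM), NE1′ ∕ NE2 at `h.params`, (D4), spine side ⇒ `Spine ₁₃CCoPH`.

HONEST FRAMING.  COMPOSITE-node bookkeeping BY NAME: THE END's data, NODE A's located input records, the numerals, (J) ∕ (A) ∕ STRIP-(1.18), NE1′, NE2, `InEndRegime ∧ LeafSlotAT`, (D4), NE7b,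
NE7c, the extraction clause and NE7's core edge are DISPLAYED hypotheses with no producer at the ₁₃ reading today (0∕1); the term data and every table ∕ record ∕ letter are PARAMETERS (no
Bałaban (2.14)–(2.26) datum is constructed here); nothing of Bałaban's asserted or instantiated; no `Provisos₁₃CoPH` inhabitant claimed (K0⁷ open); N18 ∕ N22 ∕ N27 NOT discharged; K3⁷ NOT
claimed; counts UNMOVED (typed 28∕28 · discharged 5∕27, A 5∕28); one finite four-torus programme at fixed `ε` — NOT ℝ⁴, NOT infinite volume, NOT OS, NOT a mass gap, NOT Clay.  General-`N`.
No decl below carries a cite tag.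
-/

noncomputable section

namespace Summit.QuantumFields.YangMills.Theorems.BalabanUVNodesN27SpineRecord

open Set Metric
open scoped Matrix.Norms.L2Operator

open Literature.MathematicalPhysics.QuantumFieldTheory.Balaban1983to89
open Literature.MathematicalPhysics.QuantumFieldTheory.Balaban1983to89.T4Continuum
open Literature.MathematicalPhysics.QuantumFieldTheory.Balaban1983to89.T4OutputRate (Carriers Functional NE5 DecayBound Window)
open Literature.MathematicalPhysics.QuantumFieldTheory.Balaban1983to89.TreeLengthTorus (TDom tsys torusTreeLen)
open Literature.MathematicalPhysics.QuantumFieldTheory.Balaban1983to89.T4InputCauchyRateData (StepModel)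
open Literature.MathematicalPhysics.QuantumFieldTheory.Balaban1983to89.B13Resummation (locE)
open Literature.MathematicalPhysics.QuantumFieldTheory.Balaban1983to89.TreeLengthTorusGeometry (TTouch)
open Literature.MathematicalPhysics.QuantumFieldTheory.Balaban1983to89.B12TreeDecay (K₀)
open Summit.QuantumFields.BalabanUV.T4Continuum.Spine.NE5
open YMDAG.N18.HLayer
open YMDAG.N18.W1Reading (s_N18_rRec₁₃CoPH_readingAdm_runTowers_Gn₀_of_inputs226Holo_pin s_N18_rRec₁₃CoPHOn_readingAdm_runTowers_Gn₀_of_inputs226Holo_pin n18At_u3OfRecord₁₃_readingAdm_iff)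
open T4ContinuumYM4Torus (ForSmallCouplings)
open Summit.QuantumFields.BalabanUV.T4Continuum.Spine
open YMDAG.UVSplit
open Node00 (Stage13HParams datumOfRecord₁₃CoPH IsRecordOfRecord₁₃CCoPH IsDatumOfRecord₁₃CCoPH NE3Letters₁₁ NE2Objects₁₁ ne3ConstLayerOfRecord₁₁ MatA ιSU prependCoupling)
open Node00.Sect2 (domCount domSys CPair ofBackgroundC)
open Node00.W1 (ReadingData LevelPairing LetterInputs ClusterTower pairOfRecord functionalC termC box SpRestr AdmBg)
open YMDAG.N22 (s_N22_readingOfRecord₁₃CoPH_ofRecordAdm_of_s_N18_analytic s_N22_readingOfRecord₁₃CoPHOn_ofRecordAdm_of_s_N18_stripBound)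
open Summit.QuantumFields.YangMills.BalabanUVNodes.N16Regime (InEndRegime)
open Summit.QuantumFields.YangMills.BalabanUVNodes.N16LeafSlotAllTorus (LeafSlotAT)
open Summit.QuantumFields.YangMills.BalabanUVNodes.N16AtRRec13CoPHLeafSlotAT (s_N16_rRec₁₃CoPH_of_constLayer_leafSlotAT s_N16_rRec₁₃CoPHOn_ofRecord_of_leafSlotAT)
open Literature.MathematicalPhysics.QuantumFieldTheory.Balaban1983to89.TreeLengthTorus (TPt)
open Literature.MathematicalPhysics.QuantumFieldTheory.Balaban1983to89.B13Lemma3TorusTerms (terms)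
open Literature.MathematicalPhysics.QuantumFieldTheory.Balaban1983to89.B9Thm37GlueTorus (tdist1)
open Literature.MathematicalPhysics.QuantumFieldTheory.Balaban1983to89.B13Lemma3TorusSocket (Lemma3Numerics)
open Node00.W1 (TermData214 runTowers toClusterTower OlderTerms)
open scoped BigOperators Matrix

variable {N : ℕ} [NeZero N] (cr : SpineReading₁₃CoPH N)
  {c₀ : (F : T4Family) → Stage13HParams F N → ℕ → B13.Consts} (c : (F : T4Family) → Stage13HParams F N → ℕ → B13.Consts)
  (L : (F : T4Family) → Stage13HParams F N → ℕ → ℕ) [hL : ∀ (F : T4Family) (θ : Stage13HParams F N) (k : ℕ), NeZero (L F θ k)]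
  (𝔇 : (F : T4Family) → (θ : Stage13HParams F N) → (k : ℕ) → TermData214 (c₀ F θ k) (F.P k) (MatA N) θ.τ9.M (L F θ k))
  (Dc : (F : T4Family) → Stage13HParams F N → Set ℂ)
  (sp big : (F : T4Family) → (θ : Stage13HParams F N) → (k j : ℕ) → (domSys (F.P k) θ.τ9.M j).Dom → Set (CPair (F.P k) (MatA N)))
  (gauge : (F : T4Family) → (θ : Stage13HParams F N) → (k : ℕ) → GaugeField (F.P k) 0 (Node00.SU N) → GaugeField (F.P k) 0 (Node00.SU N) → ℝ)
  (hg : ∀ (F : T4Family) (θ : Stage13HParams F N) (k : ℕ) (U U' : GaugeField (F.P k) 0 (Node00.SU N)), 0 ≤ gauge F θ k U U')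
  (T₀ : (F : T4Family) → (θ : Stage13HParams F N) → (k : ℕ) → GaugeField (F.P (k + 1)) 0 (Node00.SU N) → GaugeField (F.P k) 0 (Node00.SU N))
  (hT₀ : ∀ (F : T4Family) (θ : Stage13HParams F N) (k : ℕ) (U : GaugeField (F.P (k + 1)) 0 (Node00.SU N)),
    (∀ (j : ℕ) (Y : (domSys (F.P (k + 1)) θ.τ9.M j).Dom), ofBackgroundC (ιSU N) U ∈ sp F θ (k + 1) j Y) →
      ∀ (j : ℕ) (X : (domSys (F.P k) θ.τ9.M j).Dom), ofBackgroundC (ιSU N) (T₀ F θ k U) ∈ sp F θ k j X)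
  (li : (F : T4Family) → Stage13HParams F N → LetterInputs) (ℓ₃ : T4Family → NE3Letters₁₁)
  (ne2 : (F : T4Family) → Stage13HParams F N → (ℕ → ℝ) → List (ULoop F) → ℕ → NE2Objects₁₁)
  (ne1 : (F : T4Family) → Stage13HParams F N → (ℕ → ℝ) → List (ULoop F) → NE1pCarriers)

/-! ## The canonical home of the admissible reading on the TERM-DATA generated run towers — N18 from THE END's data and NODE A's located inputs -/

open Classical in
/-- ★ **N27 = B5 AT THE STAGE-13 `CoPH` RECORD FROM THE SLOTS AT THE CANONICAL HOME OF THE ADMISSIBLE READING ON THE RUN TOWERS GENERATED BY W1's (2.14) TERM DATA — N17 ∕ N22 ELIMINATED,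
N18 FROM THE END's DATA AND NODE A's LOCATED INPUTS PER TERM** (XLᶜᵒᵖᴴ `spine_rec13CCoPH_at_readingOfRecord₁₃CoPH` at XLIᶜᵒᵖᴴ's admissible reading with towers
`S F θ := runTowers (k ↦ toClusterTower (𝔇 F θ k).Gn₀)`; `h18` ⟸ dag-n18-d `YMDAG.N18.W1Reading.s_N18_rRec₁₃CoPH_readingAdm_runTowers_Gn₀_of_inputs226Holo_pin` at `hpin := readingOfRecord₁₃CoPH_u3 …`,
its hypothesis VERBATIM (dag-n18-c file 33 `…N18AtTermDatumInputs226` underneath — «the most located junction of node N18 in the tree»): per admissible tuple with provisos and run length,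
under `NeZero θ.τ9.M`, (i) THE END's data over the carriers of the admissible level pairing of the run towers and (ii)′ per torus `k`, `k+1`: restriction-closed tables `sp ⊆ big` (open), the
[II] (2.26) numerals of the estimate records `c F θ ·`, ONE W1 STOREY-8 located-inputs record `Inputs226Holo` per table point ∕ term under Lemma 2's guard with its analyticity ∕ symmetry ∕
positivity ∕ decay ∕ closeness clauses, the dominations, the strict [KP86] and renewal clauses, `]0, γ′] ⊆ Dc F θ`, letters dominating).  N22 ⟸ that N18 by dag-n22-e 8a″
`…_ofRecordAdm_of_s_N18_analytic` at these towers ((J), (A), eleven numerals VERBATIM); NE1′ ∕ NE2 at `h.params`; N16 as `InEndRegime ∧ LeafSlotAT` (dag-n16-e 39ᴴ); (D4); spine side as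
XLIᶜᵒᵖᴴ.  The term data `𝔇`, records `c`, tables, gauges, transports, letters are residual DATA.  Every hypothesis 0∕1 today. [bookkeeping] -/
theorem spine_rec13CCoPH_at_termDatumTowers₁₃CoPH
    (h14 : ∀ (F : T4Family) (D : Datum F N) (h : IsDatumOfRecord₁₃CCoPH F N D) (g₀ : ℕ → ℝ) (os : List (ULoop F)), N14At (ne1 F h.params g₀ os))
    (h15 : ∀ (F : T4Family) (D : Datum F N) (h : IsDatumOfRecord₁₃CCoPH F N D) (g₀ : ℕ → ℝ) (os : List (ULoop F)) (k : ℕ),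
      N15At (ne2OfRecord₁₁ (ne2 F h.params g₀ os k)))
    (h16 : ∀ (F : T4Family), (∃ D : Datum F N, IsDatumOfRecord₁₃CCoPH F N D) →
      InEndRegime (ne3OfRecord₁₁ F (ne3ConstLayerOfRecord₁₁ F N (ℓ₃ F))) ∧ LeafSlotAT (ne3OfRecord₁₁ F (ne3ConstLayerOfRecord₁₁ F N (ℓ₃ F))))
    -- N18 ⟸ THE END's data + NODE A's located inputs per term (dag-n18-d `s_N18_rRec₁₃CoPH_readingAdm_runTowers_Gn₀_of_inputs226Holo_pin`, hypothesis verbatim)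
    (h18 : ∀ (F : T4Family) (θ : Stage13HParams F N), θ.Provisos₁₃CoPH F N → θ.Admissible F N → ∀ [NeZero θ.τ9.M] (k : ℕ),
      ∃ (Op : Type) (_ : NormedAddCommGroup Op) (_ : NormedSpace ℂ Op) (Hist : Type) (_ : NormedAddCommGroup Hist) (_ : NormedSpace ℂ Hist)
        (Mb : ℝ → StepModel (LevelPairing.ofRecordAdm F θ.τ9.M N k (sp F θ) (gauge F θ k) (hg F θ k) (T₀ F θ k) (hT₀ F θ k)).carriers Op Hist)
        (act : ℝ → (j : ℕ) → Op × Hist → TDom 4 (domCount (F.P k) θ.τ9.M j) → ℂ) (γ' C3 ε₁ Rd κ A_A A_B E_A E_B E₁ δ δ' θr θ' cH ω ρ₀ B : ℝ) (k₀ : ℕ)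
        (aA a₂A a₂A' a₅A AabsA aB a₂B a₂B' a₅B AabsB : ℝ),
        (∀ b : ℝ, 0 < b → b ≤ γ' → ∀ (X : Node00.W1.Dom (F.P k) θ.τ9.M) (z : Op × Hist),
          (Mb b).Out X.1 z.1 z.2 X =
            locE (TTouch (d := 4) (N := domCount (F.P k) θ.τ9.M X.1)) (fun Z : (tsys 4 (domCount (F.P k) θ.τ9.M X.1)).Dom => Z.1)
              (act b X.1 z) X.2.1) ∧
        0 ≤ C3 ∧ 0 ≤ ε₁ ∧ 0 ≤ κ ∧ κ + 2 * (64 * Real.log 162) + 2 ≤ Rd ∧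
        C3 * ε₁ * Real.exp (5 * κ + 1) * K₀ 64 8 * 9 * 64 ≤ 1 ∧
        (∀ b : ℝ, 0 < b → b ≤ γ' → ∀ j, ∀ g ∈ Window γ',
          ∀ (U : (LevelPairing.ofRecordAdm F θ.τ9.M N k (sp F θ) (gauge F θ k) (hg F θ k) (T₀ F θ k) (hT₀ F θ k)).BgB) (q : Op × Hist), q ∈ (Mb b).Base j g U →
          ∃ V : Set (Op × Hist), IsOpen V ∧ (Mb b).box j q ⊆ V ∧
            (∀ Z : TDom 4 (domCount (F.P k) θ.τ9.M j), DifferentiableOn ℂ (fun z : Op × Hist => act b j z Z) V) ∧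
            (∀ z ∈ V, ∀ Z : TDom 4 (domCount (F.P k) θ.τ9.M j), ‖act b j z Z‖ ≤ C3 * ε₁ * Real.exp (-(Rd * torusTreeLen Z.1)))) ∧
        (∀ b : ℝ, 0 < b → b ≤ γ' → L01 (Mb b)
          ((LevelPairing.ofRecordAdm F θ.τ9.M N k (sp F θ) (gauge F θ k) (hg F θ k) (T₀ F θ k) (hT₀ F θ k)).EA (runTowers (fun k => toClusterTower ((𝔇 F θ k).Gn₀)) k)) (Window γ')) ∧
        (∀ b : ℝ, 0 < b → b ≤ γ' → L02 (Mb b)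
          ((LevelPairing.ofRecordAdm F θ.τ9.M N k (sp F θ) (gauge F θ k) (hg F θ k) (T₀ F θ k) (hT₀ F θ k)).EB (runTowers (fun k => toClusterTower ((𝔇 F θ k).Gn₀)) (k + 1)) b) (Window γ')) ∧
        (∀ b : ℝ, 0 < b → b ≤ γ' → L03 (Mb b)
          ((LevelPairing.ofRecordAdm F θ.τ9.M N k (sp F θ) (gauge F θ k) (hg F θ k) (T₀ F θ k) (hT₀ F θ k)).EB (runTowers (fun k => toClusterTower ((𝔇 F θ k).Gn₀)) (k + 1)) b) (Window γ')) ∧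
        (∀ b : ℝ, 0 < b → b ≤ γ' → L07 (Mb b) (Window γ') δ θr) ∧
        (∀ b : ℝ, 0 < b → b ≤ γ' → L08 (Mb b) (Window γ') κ (Real.exp 1 * 9 * 64 * K₀ 64 8 ^ 2 * A_B) δ' θr) ∧
        (∀ b : ℝ, 0 < b → b ≤ γ' → L09aff (Mb b) (Window γ')) ∧ (∀ b : ℝ, 0 < b → b ≤ γ' → L09blind (Mb b) (Window γ')) ∧
        (∀ b : ℝ, 0 < b → b ≤ γ' → L09hom (Mb b) (Window γ')) ∧ (∀ b : ℝ, 0 < b → b ≤ γ' → L09unit (Mb b) (Window γ') κ E₁ cH ω) ∧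
        0 < E₁ ∧ 0 ≤ δ + δ' ∧ 0 ≤ θr ∧ θr ≤ θ' ∧ θ' ≤ 1 ∧ 0 ≤ cH ∧ 0 < ω ∧ ρ₀ < 1 ∧
        (δ + δ') * θr ^ k₀ +
            cH * (Real.exp 1 * 9 * 64 * K₀ 64 8 ^ 2 * A_A + Real.exp 1 * 9 * 64 * K₀ 64 8 ^ 2 * A_B) / (1 - ω) ≤ ρ₀ ∧
        0 ≤ B ∧ (∀ k < k₀, Real.exp 1 * 9 * 64 * K₀ 64 8 ^ 2 * A_A + Real.exp 1 * 9 * 64 * K₀ 64 8 ^ 2 * A_B ≤ B * θr ^ k) ∧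
        Real.exp 1 * 9 * 64 * K₀ 64 8 ^ 2 * C3 * cH * ε₁ < (θ' - ω) * (1 - ρ₀) ∧
        (∀ m, SpRestr (sp F θ k (m + 1))) ∧
        (∀ (m : ℕ) (Z : (domSys (F.P k) θ.τ9.M (m + 1)).Dom), IsOpen (big F θ k (m + 1) Z)) ∧
        (∀ (m : ℕ) (Z : (domSys (F.P k) θ.τ9.M (m + 1)).Dom), sp F θ k (m + 1) Z ⊆ big F θ k (m + 1) Z) ∧
        1 ≤ (c F θ k).κ₁ ∧ (c F θ k).α₆ ≠ 0 ∧ 8 ≤ (c F θ k).L ∧ (c F θ k).L = L F θ k ∧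
        Lemma3Numerics (c F θ k) θ.τ9.M (((c F θ k).L : ℝ) / 2) aA a₂A a₂A' a₅A AabsA ∧
        (∀ m : ℕ, ∀ s ∈ Dc F θ, ∀ old : OlderTerms (F.P k) (MatA N) θ.τ9.M m,
          (∀ (j : Fin (m + 1)) (Y : (domSys (F.P k) θ.τ9.M j).Dom), ∀ ψ ∈ sp F θ k j Y, ‖old j Y ψ‖ ≤ E_A * Real.exp (-(κ * (domSys (F.P k) θ.τ9.M j).dj Y))) →
          (∀ (j : Fin (m + 1)) (Y : (domSys (F.P k) θ.τ9.M j).Dom), AnalyticOnNhd ℂ (old j Y) (sp F θ k j Y)) →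
          ∀ (Z : (domSys (F.P k) θ.τ9.M (m + 1)).Dom), ∀ t ∈ terms (L F θ k) θ.τ9.M Z, ∀ φ₁ ∈ big F θ k (m + 1) Z,
            ∃ ι : (𝔇 F θ k m).Inputs226Holo (c F θ k) Z t s old φ₁ aA a₅A,
            (∀ φ ∈ big F θ k (m + 1) Z, ∀ i j, DifferentiableOn ℂ (fun σ => (𝔇 F θ k m).A Z t φ σ i j) {σ | ∀ j, σ j ∈ ι.Uσ}) ∧
            (∀ φ ∈ big F θ k (m + 1) Z, ∀ i j, DifferentiableOn ℂ (fun σ => ((𝔇 F θ k m).𝒦 Z t).G2 σ ((𝔇 F θ k m).uOf Z t φ) i j) {σ | ∀ j, σ j ∈ ι.Uσ}) ∧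
            (∀ σ : TPt (F.P k).d (domCount (F.P k) θ.τ9.M (m + 1)) → ℂ, (∀ j, σ j ∈ ι.Uσ) →
              ∀ i j, DifferentiableOn ℂ (fun φ => (𝔇 F θ k m).A Z t φ σ i j) (big F θ k (m + 1) Z)) ∧
            (∀ σ : TPt (F.P k).d (domCount (F.P k) θ.τ9.M (m + 1)) → ℂ, (∀ j, σ j ∈ ι.Uσ) →
              ∀ i j, DifferentiableOn ℂ (fun φ => ((𝔇 F θ k m).𝒦 Z t).G2 σ ((𝔇 F θ k m).uOf Z t φ) i j) (big F θ k (m + 1) Z)) ∧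
            (∀ Y B, DifferentiableOn ℂ (fun φ => (𝔇 F θ k m).𝒱 Z t s old φ Y B) (big F θ k (m + 1) Z)) ∧
            (∀ φ ∈ big F θ k (m + 1) Z, ∀ Y, Measurable ((𝔇 F θ k m).𝒱 Z t s old φ Y)) ∧
            (∀ φ ∈ big F θ k (m + 1) Z, ∀ σ : TPt (F.P k).d (domCount (F.P k) θ.τ9.M (m + 1)) → ℂ, (∀ j, σ j ∈ ι.Uσ) → ((𝔇 F θ k m).A Z t φ σ).IsSymm) ∧
            (∀ φ ∈ big F θ k (m + 1) Z, ∀ σ : TPt (F.P k).d (domCount (F.P k) θ.τ9.M (m + 1)) → ℂ, (∀ j, σ j ∈ ι.Uσ) →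
              (((𝔇 F θ k m).A Z t φ σ).map Complex.re).PosDef) ∧
            (∀ φ ∈ big F θ k (m + 1) Z, ∀ τ : TDom (F.P k).d ((L F θ k) * domCount (F.P k) θ.τ9.M (m + 1)) → ℂ, (∀ Y, τ Y ∈ ι.Uτ Y) →
              ∀ B, ∑ Y ∈ t.1, ‖τ Y‖ * ‖(𝔇 F θ k m).𝒱 Z t s old φ Y B‖ ≤ ι.a₂₀ / 2 * (B ⬝ᵥ B) + ι.w) ∧
            (∀ φ ∈ big F θ k (m + 1) Z, ∀ σ : TPt (F.P k).d (domCount (F.P k) θ.τ9.M (m + 1)) → ℂ, (∀ j, σ j ∈ ι.Uσ) →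
              ∀ b j, ‖((𝔇 F θ k m).𝒦 Z t).G2 σ ((𝔇 F θ k m).uOf Z t φ) b j‖ ≤
                ι.KG * Real.exp (-(ι.kap * tdist1 (𝔇 F θ k m).Nf (((𝔇 F θ k m).𝒦 Z t).locΛ b) (((𝔇 F θ k m).𝒦 Z t).locN j)))) ∧
            (∀ φ ∈ big F θ k (m + 1) Z, ∀ σ : TPt (F.P k).d (domCount (F.P k) θ.τ9.M (m + 1)) → ℂ, (∀ j, σ j ∈ ι.Uσ) →
              ∀ b b', ‖((𝔇 F θ k m).A Z t φ σ)⁻¹ b b'‖ ≤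
                ι.KCs * Real.exp (-(ι.kap * tdist1 (𝔇 F θ k m).Nf (((𝔇 F θ k m).𝒦 Z t).locΛ b) (((𝔇 F θ k m).𝒦 Z t).locΛ b')))) ∧
            (∀ φ ∈ big F θ k (m + 1) Z, ∀ σ : TPt (F.P k).d (domCount (F.P k) θ.τ9.M (m + 1)) → ℂ, (∀ j, σ j ∈ ι.Uσ) →
              ∀ b j, ‖(((𝔇 F θ k m).𝒦 Z t).G2 σ ((𝔇 F θ k m).uOf Z t φ) - ((𝔇 F θ k m).𝒦 Z t).Γ₀.map (algebraMap ℝ ℂ)) b j‖ ≤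
                ι.θΓ * Real.exp (-(ι.kap * tdist1 (𝔇 F θ k m).Nf (((𝔇 F θ k m).𝒦 Z t).locΛ b) (((𝔇 F θ k m).𝒦 Z t).locN j)))) ∧
            (∀ φ ∈ big F θ k (m + 1) Z, ∀ σ : TPt (F.P k).d (domCount (F.P k) θ.τ9.M (m + 1)) → ℂ, (∀ j, σ j ∈ ι.Uσ) →
              ∀ b b', ‖(((𝔇 F θ k m).A Z t φ σ)⁻¹ - ((𝔇 F θ k m).𝒦 Z t).C.map (algebraMap ℝ ℂ)) b b'‖ ≤
                ι.θC * Real.exp (-(ι.kap * tdist1 (𝔇 F θ k m).Nf (((𝔇 F θ k m).𝒦 Z t).locΛ b) (((𝔇 F θ k m).𝒦 Z t).locΛ b')))) ∧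
            (∀ φ ∈ big F θ k (m + 1) Z, ∀ σ : TPt (F.P k).d (domCount (F.P k) θ.τ9.M (m + 1)) → ℂ, (∀ j, σ j ∈ ι.Uσ) →
              ∀ b b', ‖((𝔇 F θ k m).A Z t φ σ - ((𝔇 F θ k m).𝒦 Z t).C⁻¹.map (algebraMap ℝ ℂ)) b b'‖ ≤
                ι.θE * Real.exp (-(ι.kap * tdist1 (𝔇 F θ k m).Nf (((𝔇 F θ k m).𝒦 Z t).locΛ b) (((𝔇 F θ k m).𝒦 Z t).locΛ b'))))) ∧
        0 ≤ (c F θ k).C3act * (c F θ k).ε₁ ∧ (c F θ k).C3act * (c F θ k).ε₁ ≤ A_A ∧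
        Rd ≤ (1 - 8 * (c F θ k).δ) * (((c F θ k).L : ℝ) / 2) * (c F θ k).κ ∧
        A_A * Real.exp (5 * κ + 1) * K₀ 64 8 * 9 * 64 < 1 ∧ Real.exp 1 * 9 * 64 * K₀ 64 8 ^ 2 * A_A ≤ E_A ∧
        (∀ m, SpRestr (sp F θ (k + 1) (m + 1))) ∧
        (∀ (m : ℕ) (Z : (domSys (F.P (k + 1)) θ.τ9.M (m + 1)).Dom), IsOpen (big F θ (k + 1) (m + 1) Z)) ∧
        (∀ (m : ℕ) (Z : (domSys (F.P (k + 1)) θ.τ9.M (m + 1)).Dom), sp F θ (k + 1) (m + 1) Z ⊆ big F θ (k + 1) (m + 1) Z) ∧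
        1 ≤ (c F θ (k + 1)).κ₁ ∧ (c F θ (k + 1)).α₆ ≠ 0 ∧ 8 ≤ (c F θ (k + 1)).L ∧ (c F θ (k + 1)).L = L F θ (k + 1) ∧
        Lemma3Numerics (c F θ (k + 1)) θ.τ9.M (((c F θ (k + 1)).L : ℝ) / 2) aB a₂B a₂B' a₅B AabsB ∧
        (∀ m : ℕ, ∀ s ∈ Dc F θ, ∀ old : OlderTerms (F.P (k + 1)) (MatA N) θ.τ9.M m,
          (∀ (j : Fin (m + 1)) (Y : (domSys (F.P (k + 1)) θ.τ9.M j).Dom), ∀ ψ ∈ sp F θ (k + 1) j Y, ‖old j Y ψ‖ ≤ E_B * Real.exp (-(κ * (domSys (F.P (k + 1)) θ.τ9.M j).dj Y))) →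
          (∀ (j : Fin (m + 1)) (Y : (domSys (F.P (k + 1)) θ.τ9.M j).Dom), AnalyticOnNhd ℂ (old j Y) (sp F θ (k + 1) j Y)) →
          ∀ (Z : (domSys (F.P (k + 1)) θ.τ9.M (m + 1)).Dom), ∀ t ∈ terms (L F θ (k + 1)) θ.τ9.M Z, ∀ φ₁ ∈ big F θ (k + 1) (m + 1) Z,
            ∃ ι : (𝔇 F θ (k + 1) m).Inputs226Holo (c F θ (k + 1)) Z t s old φ₁ aB a₅B,
            (∀ φ ∈ big F θ (k + 1) (m + 1) Z, ∀ i j, DifferentiableOn ℂ (fun σ => (𝔇 F θ (k + 1) m).A Z t φ σ i j) {σ | ∀ j, σ j ∈ ι.Uσ}) ∧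
            (∀ φ ∈ big F θ (k + 1) (m + 1) Z, ∀ i j, DifferentiableOn ℂ (fun σ => ((𝔇 F θ (k + 1) m).𝒦 Z t).G2 σ ((𝔇 F θ (k + 1) m).uOf Z t φ) i j) {σ | ∀ j, σ j ∈ ι.Uσ}) ∧
            (∀ σ : TPt (F.P (k + 1)).d (domCount (F.P (k + 1)) θ.τ9.M (m + 1)) → ℂ, (∀ j, σ j ∈ ι.Uσ) →
              ∀ i j, DifferentiableOn ℂ (fun φ => (𝔇 F θ (k + 1) m).A Z t φ σ i j) (big F θ (k + 1) (m + 1) Z)) ∧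
            (∀ σ : TPt (F.P (k + 1)).d (domCount (F.P (k + 1)) θ.τ9.M (m + 1)) → ℂ, (∀ j, σ j ∈ ι.Uσ) →
              ∀ i j, DifferentiableOn ℂ (fun φ => ((𝔇 F θ (k + 1) m).𝒦 Z t).G2 σ ((𝔇 F θ (k + 1) m).uOf Z t φ) i j) (big F θ (k + 1) (m + 1) Z)) ∧
            (∀ Y B, DifferentiableOn ℂ (fun φ => (𝔇 F θ (k + 1) m).𝒱 Z t s old φ Y B) (big F θ (k + 1) (m + 1) Z)) ∧
            (∀ φ ∈ big F θ (k + 1) (m + 1) Z, ∀ Y, Measurable ((𝔇 F θ (k + 1) m).𝒱 Z t s old φ Y)) ∧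
            (∀ φ ∈ big F θ (k + 1) (m + 1) Z, ∀ σ : TPt (F.P (k + 1)).d (domCount (F.P (k + 1)) θ.τ9.M (m + 1)) → ℂ, (∀ j, σ j ∈ ι.Uσ) → ((𝔇 F θ (k + 1) m).A Z t φ σ).IsSymm) ∧
            (∀ φ ∈ big F θ (k + 1) (m + 1) Z, ∀ σ : TPt (F.P (k + 1)).d (domCount (F.P (k + 1)) θ.τ9.M (m + 1)) → ℂ, (∀ j, σ j ∈ ι.Uσ) →
              (((𝔇 F θ (k + 1) m).A Z t φ σ).map Complex.re).PosDef) ∧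
            (∀ φ ∈ big F θ (k + 1) (m + 1) Z, ∀ τ : TDom (F.P (k + 1)).d ((L F θ (k + 1)) * domCount (F.P (k + 1)) θ.τ9.M (m + 1)) → ℂ, (∀ Y, τ Y ∈ ι.Uτ Y) →
              ∀ B, ∑ Y ∈ t.1, ‖τ Y‖ * ‖(𝔇 F θ (k + 1) m).𝒱 Z t s old φ Y B‖ ≤ ι.a₂₀ / 2 * (B ⬝ᵥ B) + ι.w) ∧
            (∀ φ ∈ big F θ (k + 1) (m + 1) Z, ∀ σ : TPt (F.P (k + 1)).d (domCount (F.P (k + 1)) θ.τ9.M (m + 1)) → ℂ, (∀ j, σ j ∈ ι.Uσ) →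
              ∀ b j, ‖((𝔇 F θ (k + 1) m).𝒦 Z t).G2 σ ((𝔇 F θ (k + 1) m).uOf Z t φ) b j‖ ≤
                ι.KG * Real.exp (-(ι.kap * tdist1 (𝔇 F θ (k + 1) m).Nf (((𝔇 F θ (k + 1) m).𝒦 Z t).locΛ b) (((𝔇 F θ (k + 1) m).𝒦 Z t).locN j)))) ∧
            (∀ φ ∈ big F θ (k + 1) (m + 1) Z, ∀ σ : TPt (F.P (k + 1)).d (domCount (F.P (k + 1)) θ.τ9.M (m + 1)) → ℂ, (∀ j, σ j ∈ ι.Uσ) →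
              ∀ b b', ‖((𝔇 F θ (k + 1) m).A Z t φ σ)⁻¹ b b'‖ ≤
                ι.KCs * Real.exp (-(ι.kap * tdist1 (𝔇 F θ (k + 1) m).Nf (((𝔇 F θ (k + 1) m).𝒦 Z t).locΛ b) (((𝔇 F θ (k + 1) m).𝒦 Z t).locΛ b')))) ∧
            (∀ φ ∈ big F θ (k + 1) (m + 1) Z, ∀ σ : TPt (F.P (k + 1)).d (domCount (F.P (k + 1)) θ.τ9.M (m + 1)) → ℂ, (∀ j, σ j ∈ ι.Uσ) →
              ∀ b j, ‖(((𝔇 F θ (k + 1) m).𝒦 Z t).G2 σ ((𝔇 F θ (k + 1) m).uOf Z t φ) - ((𝔇 F θ (k + 1) m).𝒦 Z t).Γ₀.map (algebraMap ℝ ℂ)) b j‖ ≤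
                ι.θΓ * Real.exp (-(ι.kap * tdist1 (𝔇 F θ (k + 1) m).Nf (((𝔇 F θ (k + 1) m).𝒦 Z t).locΛ b) (((𝔇 F θ (k + 1) m).𝒦 Z t).locN j)))) ∧
            (∀ φ ∈ big F θ (k + 1) (m + 1) Z, ∀ σ : TPt (F.P (k + 1)).d (domCount (F.P (k + 1)) θ.τ9.M (m + 1)) → ℂ, (∀ j, σ j ∈ ι.Uσ) →
              ∀ b b', ‖(((𝔇 F θ (k + 1) m).A Z t φ σ)⁻¹ - ((𝔇 F θ (k + 1) m).𝒦 Z t).C.map (algebraMap ℝ ℂ)) b b'‖ ≤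
                ι.θC * Real.exp (-(ι.kap * tdist1 (𝔇 F θ (k + 1) m).Nf (((𝔇 F θ (k + 1) m).𝒦 Z t).locΛ b) (((𝔇 F θ (k + 1) m).𝒦 Z t).locΛ b')))) ∧
            (∀ φ ∈ big F θ (k + 1) (m + 1) Z, ∀ σ : TPt (F.P (k + 1)).d (domCount (F.P (k + 1)) θ.τ9.M (m + 1)) → ℂ, (∀ j, σ j ∈ ι.Uσ) →
              ∀ b b', ‖((𝔇 F θ (k + 1) m).A Z t φ σ - ((𝔇 F θ (k + 1) m).𝒦 Z t).C⁻¹.map (algebraMap ℝ ℂ)) b b'‖ ≤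
                ι.θE * Real.exp (-(ι.kap * tdist1 (𝔇 F θ (k + 1) m).Nf (((𝔇 F θ (k + 1) m).𝒦 Z t).locΛ b) (((𝔇 F θ (k + 1) m).𝒦 Z t).locΛ b'))))) ∧
        0 ≤ (c F θ (k + 1)).C3act * (c F θ (k + 1)).ε₁ ∧ (c F θ (k + 1)).C3act * (c F θ (k + 1)).ε₁ ≤ A_B ∧
        Rd ≤ (1 - 8 * (c F θ (k + 1)).δ) * (((c F θ (k + 1)).L : ℝ) / 2) * (c F θ (k + 1)).κ ∧
        A_B * Real.exp (5 * κ + 1) * K₀ 64 8 * 9 * 64 < 1 ∧ Real.exp 1 * 9 * 64 * K₀ 64 8 ^ 2 * A_B ≤ E_B ∧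
        (∀ s ∈ Ioc (0 : ℝ) γ', ((s : ℝ) : ℂ) ∈ Dc F θ) ∧
        θ.γ ≤ γ' ∧ (li F θ).κ ≤ κ ∧ θ' ≤ (li F θ).θ₅ ∧
        (Real.exp 1 * 9 * 64 * K₀ 64 8 ^ 2 * (C3 * ε₁) / (1 - ρ₀) * (δ + δ') + B) * (θ' - ω) /
            (θ' - (ω + Real.exp 1 * 9 * 64 * K₀ 64 8 ^ 2 * (C3 * ε₁) / (1 - ρ₀) * cH)) ≤ (li F θ).C₅)
    -- N22 ⟸ N18 (dag-n22-e module 8a″, analytic sup-letter currency): (J), (A) over ADMISSIBLE run-A fields, eleven numerals — verbatim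
    (hjunk : ∀ (F : T4Family) (θ : Stage13HParams F N), θ.Provisos₁₃CoPH F N → θ.Admissible F N →
      ∀ (k : ℕ) (X : Node00.W1.Dom (F.P k) θ.τ9.M), k < X.1 → ∀ (g : ℕ → ℝ) (φ : CPair (F.P k) (MatA N)), functionalC (runTowers (fun k => toClusterTower (𝔇 F θ k).Gn₀) k) g φ X = 0)
    (hA : ∀ (F : T4Family) (θ : Stage13HParams F N), θ.Provisos₁₃CoPH F N → θ.Admissible F N → ∀ (k : ℕ),
      ∀ g ∈ Window θ.γ, ∀ (U : AdmBg F θ.τ9.M N (sp F θ) k) (X : Node00.W1.Dom (F.P k) θ.τ9.M) (i : ℕ), i < X.1 →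
        ∃ (Fz : ℂ → ℂ) (Dset : Set ℂ), DifferentiableOn ℂ Fz Dset ∧
          (∀ z ∈ Dset, ‖Fz z‖ ≤ (li F θ).A * (li F θ).μ ^ (X.1 - 1 - i) * Real.exp (-((li F θ).κ * (domSys (F.P k) θ.τ9.M X.1).dj X.2))) ∧
          (∀ t ∈ Ioc (0 : ℝ) θ.γ, closedBall (t : ℂ) (li F θ).r ⊆ Dset) ∧
          (∀ t ∈ Ioc (0 : ℝ) θ.γ, Fz t = ((functionalC (runTowers (fun k => toClusterTower (𝔇 F θ k).Gn₀) k) (Function.update g i t) (ofBackgroundC (ιSU N) U.1) X).re : ℂ)))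
    (hnum : ∀ (F : T4Family) (θ : Stage13HParams F N), θ.Provisos₁₃CoPH F N → θ.Admissible F N →
      0 < (li F θ).C₀ ∧ 0 < (li F θ).θ₅ ∧ (li F θ).θ₅ < 1 ∧ 0 ≤ (li F θ).C₅ ∧ 2 * (li F θ).C₅ / (1 - (li F θ).θ₅) ≤ (li F θ).C₀ ∧ 0 < (li F θ).A ∧
        (li F θ).θ₅ ≤ (li F θ).μ ∧ (li F θ).C₀ ≤ 2 * (li F θ).A ∧ 0 < (li F θ).r ∧ 0 < (li F θ).s ∧ (li F θ).s < 1)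
    (hD4 : ∀ (F : T4Family) (D : Datum F N) (h : IsDatumOfRecord₁₃CCoPH F N D) (k : ℕ), ReadOutAt D (u3OfRecord₁₃ h.params.toStage13Params
      ((ReadingData.ofRecordAdm F h.params.τ9.M N (runTowers fun k => toClusterTower (𝔇 F h.params k).Gn₀) (sp F h.params) (gauge F h.params) (hg F h.params) (T₀ F h.params) (hT₀ F h.params)
        (li F h.params)).u3Objects h.params.γ) k))
    (hx' : S_N27x (fun F D w => IsRecordOfRecord₁₃CCoPH F N D w) (SRec₁₃CoPH cr)) (h20 : S_N20 (SRec₁₃CoPH cr)) (h21 : S_N21 (SRec₁₃CoPH cr))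
    (h19 : ∀ (F : T4Family) (θ : Stage13HParams F N) (hP : θ.Provisos₁₃CoPH F N), θ.Admissible F N → ∀ (g₀ : ℕ → ℝ) (os : List (ULoop F))
      (h : IsDatumOfRecord₁₃CCoPH F N (datumOfRecord₁₃CoPH F N θ hP)) (k : ℕ),
      RatesAt (datumOfRecord₁₃CoPH F N θ hP) (rateCarriersOfRecord₁₃CoPH (readingOfRecord₁₃CoPH
        (fun F θ => ReadingData.ofRecordAdm F θ.τ9.M N (runTowers fun k => toClusterTower (𝔇 F θ k).Gn₀) (sp F θ) (gauge F θ) (hg F θ) (T₀ F θ) (hT₀ F θ) (li F θ)) ℓ₃ ne2 ne1)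
          F h.params h.provisos g₀ os k) → letI := (cr F θ hP g₀ os).dec
        ∃ δ : ℕ → ℝ, NE7.Core (cr F θ hP g₀ os).l₀ (cr F θ hP g₀ os).vol (cr F θ hP g₀ os).T (cr F θ hP g₀ os).Bad
          (fun K t τ => (cr F θ hP g₀ os).A K t τ - (cr F θ hP g₀ os).shA K t τ) (fun K t τ => (cr F θ hP g₀ os).B K t τ - (cr F θ hP g₀ os).shB K t τ) δ ∧
          Summable δ) :
    Spine (N := N) fun F D w => IsRecordOfRecord₁₃CCoPH F N D w :=
  have h18' : S_N18 (RRec₁₃CoPH (readingOfRecord₁₃CoPH (fun F θ => ReadingData.ofRecordAdm F θ.τ9.M N (runTowers fun k => toClusterTower (𝔇 F θ k).Gn₀) (sp F θ) (gauge F θ) (hg F θ) (T₀ F θ) (hT₀ F θ) (li F θ)) ℓ₃ ne2 ne1)) :=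
    s_N18_rRec₁₃CoPH_readingAdm_runTowers_Gn₀_of_inputs226Holo_pin (𝔯 := _) (c := c) (L := L) (𝔇 := 𝔇) (D := Dc) (sp := sp) (big := big) (gauge := gauge) (hg := hg)
      (T₀ := T₀) (hT := hT₀) (li := li) (readingOfRecord₁₃CoPH_u3 _ ℓ₃ ne2 ne1) h18
  spine_rec13CCoPH_at_readingOfRecord₁₃CoPH cr _ ℓ₃ ne2 ne1 ((s_N14_readingOfRecord₁₃CoPH_iff _ ℓ₃ ne2 ne1).mpr h14) ((s_N15_readingOfRecord₁₃CoPH_iff _ ℓ₃ ne2 ne1).mpr h15)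
    (s_N16_rRec₁₃CoPH_of_constLayer_leafSlotAT (readingOfRecord₁₃CoPH _ ℓ₃ ne2 ne1) (fun F => ne3ConstLayerOfRecord₁₁ F N (ℓ₃ F)) (fun _ _ _ _ _ _ => rfl) h16) h18'
    (s_N22_readingOfRecord₁₃CoPH_ofRecordAdm_of_s_N18_analytic (fun F θ => runTowers fun k => toClusterTower (𝔇 F θ k).Gn₀) sp gauge hg T₀ hT₀ li ℓ₃ ne2 ne1 h18' hjunk hA hnum)
    ((s_D4_readingOfRecord₁₃CoPH_iff _ ℓ₃ ne2 ne1).mpr hD4) hx' h20 h21 h19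

end Summit.QuantumFields.YangMills.Theorems.BalabanUVNodesN27SpineRecord

end
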